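import Summits.MatrixMultiplication.OmegaCensus.RadonProjection3
import Mathlib.Algebra.BigOperators.Ring.Finset
import HarnessLib

/-!
# First moments of a second projection along the fibres of a three-set cube form (the weighted Radon identity)

ω-census `pub-omega`, family (b3), seat pub-omega-group gen 37.  Framing: lottery ticket; floor = certified bounds/negative
ranges.  VALUE: the JOINT two-projection identity behind the kernel theorems for the census cells `(3,3,12)@325` and
`(3,4,9)@325` of `ℤ₅ × ℤ₆₅ = ℤ₅² × ℤ₁₃` (`ThreeSetZ5Z65Cells3x.lean`), which are not reachable by any single quotient; NOT
progress on ω.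

Setting.  A three-set cube SYMMETRIC form `(W, X, Y, x₀)` over a finite abelian group `A`
(`CubeSymmetricForm.cube_symmetric_form_of_law`): the signed sumsets `−W+X+Y`, `W−X+Y`, `W+X−Y` are direct, pairwise disjoint
and cover `A ∖ {x₀}`.  Fix a quotient `φ : A →+ B` (`B` finite) and ANY additive map `Ψ : A →+ R` into a commutative ring.
For `Z ∈ {W, X, Y}` write `Zc(v) = |Z ∩ φ⁻¹(v)|` (fibre counts, cast to `R`) and `Zs(v) = Σ_{z ∈ Z ∩ φ⁻¹(v)} Ψ z` (fibre
sums).  Summing `Ψ` instead of `1` over each `φ`-fibre of the cover gives, for every `t : B`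
(**`fibre_moment_identity`**, the `Ψ`-weighted form of `RadonProjection3.radon_identity₃`):
`Σ_u Σ_v [ Ws(v)·(−Xc(t−u+v) + Xc(v+u−t) + Xc(t+u−v))·Yc(u) + Wc(v)·(Xs(t−u+v) − Xs(v+u−t) + Xs(t+u−v))·Yc(u)`
`        + Wc(v)·(Xc(t−u+v) + Xc(v+u−t) − Xc(t+u−v))·Ys(u) ] + [φ x₀ = t]·Ψ x₀ = Σ_{a ∈ φ⁻¹(t)} Ψ a`.
* **`fibre_moment_collected`** — the same left side collected by the unknowns: `Σ_v Ws v·α(t,v) + Σ_r Xs r·β(t,r) +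
  Σ_u Ys u·γ(t,u)` with the coefficient functions `momA`, `momB`, `momC` of `(Wc, Xc, Yc)` (pure algebra over `B`);
* **`moment_pairing`** — pairing the collected identities with a test vector `λ : B → R`:
  `Σ_v Ws v·(Σ_t λ t α(t,v)) + Σ_r Xs r·(Σ_t λ t β(t,r)) + Σ_u Ys u·(Σ_t λ t γ(t,u)) + λ(s)·s₀ = Σ_t λ t·ρ t`.
With `B = ℤ₅²`, `R = ZMod 13` and the rigid `ℤ₅²` data of the two cells, explicit `λ`'s isolate `Ws(e₁)` and `Ws(e₂)` and force
them to vanish (`ThreeSetZ5Z65Cells3x.lean`).  Nothing here is specific to `ℤ₅² × ℤ₁₃`.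
-/

namespace Summit.MatrixMultiplication.OmegaCensus

open Finset

namespace FibreMoment

section Moment

variable {A B R : Type*} [AddCommGroup A] [DecidableEq A] [AddCommGroup B] [Fintype B] [DecidableEq B] [CommRing R]

/-- Fibre sum of `Ψ` over `Z ∩ φ⁻¹(v)`. [folklore] -/
def fsum (φ : A →+ B) (Ψ : A →+ R) (Z : Finset A) (v : B) : R := ∑ a ∈ Z.filter (fun a => φ a = v), Ψ a

/-- Fibre count `|Z ∩ φ⁻¹(v)|` cast into `R`. [folklore] -/
def fcnt (φ : A →+ B) (Z : Finset A) (v : B) : R := ((Z.filter fun a => φ a = v).card : R)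

omit [Fintype B] [DecidableEq A] in
/-- A weighted sum over a product of three fibres `W_v × X_r × Y_u` of `ε₁Ψ w + ε₂Ψ x + ε₃Ψ y`. [folklore] -/
theorem sum_weight_product (φ : A →+ B) (Ψ : A →+ R) (W X Y : Finset A) (v r u : B) (ε₁ ε₂ ε₃ : R) :
    ∑ p ∈ (W.filter fun a => φ a = v) ×ˢ (X.filter fun a => φ a = r) ×ˢ (Y.filter fun a => φ a = u),
        (ε₁ * Ψ p.1 + ε₂ * Ψ p.2.1 + ε₃ * Ψ p.2.2) =
      ε₁ * fsum φ Ψ W v * fcnt φ X r * fcnt φ Y u + ε₂ * fcnt φ W v * fsum φ Ψ X r * fcnt φ Y u +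
        ε₃ * fcnt φ W v * fcnt φ X r * fsum φ Ψ Y u := by
  unfold fsum fcnt
  set Wv := W.filter fun a => φ a = v
  set Xr := X.filter fun a => φ a = r
  set Yu := Y.filter fun a => φ a = u
  have e1 : ∑ p ∈ Wv ×ˢ Xr ×ˢ Yu, (ε₁ * Ψ p.1 + ε₂ * Ψ p.2.1 + ε₃ * Ψ p.2.2) =
      ∑ w ∈ Wv, ∑ z ∈ Xr ×ˢ Yu, (ε₁ * Ψ w + ε₂ * Ψ z.1 + ε₃ * Ψ z.2) :=
    Finset.sum_product' Wv (Xr ×ˢ Yu) (fun w (z : A × A) => ε₁ * Ψ w + ε₂ * Ψ z.1 + ε₃ * Ψ z.2)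
  have e2 : ∀ w : A, ∑ z ∈ Xr ×ˢ Yu, (ε₁ * Ψ w + ε₂ * Ψ z.1 + ε₃ * Ψ z.2) =
      ∑ x ∈ Xr, ∑ y ∈ Yu, (ε₁ * Ψ w + ε₂ * Ψ x + ε₃ * Ψ y) := fun w =>
    Finset.sum_product' Xr Yu (fun x y => ε₁ * Ψ w + ε₂ * Ψ x + ε₃ * Ψ y)
  rw [e1, sum_congr rfl fun w _ => e2 w]
  simp only [sum_add_distrib, sum_const, nsmul_eq_mul, ← mul_sum]
  ring

omit [DecidableEq A] in
/-- Fibrewise decomposition of a weighted sum over the triples with `φ x = r (φ w) (φ y)`. [folklore] -/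
theorem sum_filter_triples_eq_sum (φ : A →+ B) (Ψ : A →+ R) (W X Y : Finset A) (P : A → A → A → Prop)
    [DecidablePred fun p : A × A × A => P p.1 p.2.1 p.2.2]
    (rB : B → B → B) (hP : ∀ w x y, P w x y ↔ φ x = rB (φ w) (φ y)) (ε₁ ε₂ ε₃ : R) :
    ∑ p ∈ (W ×ˢ X ×ˢ Y).filter (fun p : A × A × A => P p.1 p.2.1 p.2.2), (ε₁ * Ψ p.1 + ε₂ * Ψ p.2.1 + ε₃ * Ψ p.2.2) =
      ∑ u : B, ∑ v : B, (ε₁ * fsum φ Ψ W v * fcnt φ X (rB v u) * fcnt φ Y u +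
        ε₂ * fcnt φ W v * fsum φ Ψ X (rB v u) * fcnt φ Y u + ε₃ * fcnt φ W v * fcnt φ X (rB v u) * fsum φ Ψ Y u) := by
  classical
  rw [← sum_fiberwise_of_maps_to (g := fun p : A × A × A => (φ p.2.2, φ p.1)) (t := (univ : Finset (B × B)))
    (fun _ _ => mem_univ _), ← univ_product_univ, sum_product]
  refine sum_congr rfl fun u _ => sum_congr rfl fun v _ => ?_
  have : ((W ×ˢ X ×ˢ Y).filter fun p : A × A × A => P p.1 p.2.1 p.2.2).filter
      (fun p : A × A × A => (φ p.2.2, φ p.1) = (u, v)) =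
      (W.filter fun a => φ a = v) ×ˢ (X.filter fun a => φ a = rB v u) ×ˢ (Y.filter fun a => φ a = u) := by
    ext ⟨w, x, y⟩
    simp only [mem_filter, mem_product, hP, Prod.mk.injEq]
    constructor
    · rintro ⟨⟨⟨hw, hx, hy⟩, hxe⟩, hu, hv⟩
      exact ⟨⟨hw, hv⟩, ⟨hx, by rw [hxe, hu, hv]⟩, hy, hu⟩
    · rintro ⟨⟨hw, hv⟩, ⟨hx, hxe⟩, hy, hu⟩
      exact ⟨⟨⟨hw, hx, hy⟩, by rw [hxe, hu, hv]⟩, hu, hv⟩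
  rw [this, sum_weight_product]

omit [Fintype B] in
/-- The `Ψ`-sum over a fibre of an injective image of triples is the `Ψ ∘ g`-sum over the fibre of the triples. [folklore] -/
theorem sum_filter_image₃_of_injOn (φ : A →+ B) (Ψ : A →+ R) {S : Finset (A × A × A)} {g : A × A × A → A}
    (hg : Set.InjOn g ↑S) (t : B) :
    ∑ a ∈ (S.image g).filter (fun a => φ a = t), Ψ a = ∑ p ∈ S.filter (fun p => φ (g p) = t), Ψ (g p) := by
  rw [filter_image, sum_image (hg.mono (by intro p hp; exact (mem_filter.1 (mem_coe.1 hp)).1))]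

/-- `Ψ`-sums over the fibres of the direct signed sumset `−W + X + Y`. [folklore] -/
theorem sum_fibre_box₁ (φ : A →+ B) (Ψ : A →+ R) {W X Y : Finset A}
    (hinj : Set.InjOn (fun p : A × A × A => -p.1 + p.2.1 + p.2.2) ↑(W ×ˢ X ×ˢ Y)) (t : B) :
    ∑ a ∈ ((W ×ˢ X ×ˢ Y).image fun p : A × A × A => -p.1 + p.2.1 + p.2.2).filter (fun a => φ a = t), Ψ a =
      ∑ u : B, ∑ v : B, ((-1) * fsum φ Ψ W v * fcnt φ X (t - u + v) * fcnt φ Y u +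
        1 * fcnt φ W v * fsum φ Ψ X (t - u + v) * fcnt φ Y u + 1 * fcnt φ W v * fcnt φ X (t - u + v) * fsum φ Ψ Y u) := by
  rw [sum_filter_image₃_of_injOn φ Ψ hinj t]
  have e : ∀ p : A × A × A, Ψ (-p.1 + p.2.1 + p.2.2) = (-1) * Ψ p.1 + 1 * Ψ p.2.1 + 1 * Ψ p.2.2 := fun p => by
    rw [map_add, map_add, map_neg]; ring
  simp_rw [e]
  exact sum_filter_triples_eq_sum φ Ψ W X Y (fun w x y => φ (-w + x + y) = t) (fun v u => t - u + v)
    (fun w x y => by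
      rw [map_add, map_add, map_neg]
      constructor
      · intro h; rw [← h]; abel
      · intro h; rw [h]; abel) _ _ _

/-- `Ψ`-sums over the fibres of the direct signed sumset `W − X + Y`. [folklore] -/
theorem sum_fibre_box₂ (φ : A →+ B) (Ψ : A →+ R) {W X Y : Finset A}
    (hinj : Set.InjOn (fun p : A × A × A => p.1 - p.2.1 + p.2.2) ↑(W ×ˢ X ×ˢ Y)) (t : B) :
    ∑ a ∈ ((W ×ˢ X ×ˢ Y).image fun p : A × A × A => p.1 - p.2.1 + p.2.2).filter (fun a => φ a = t), Ψ a =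
      ∑ u : B, ∑ v : B, (1 * fsum φ Ψ W v * fcnt φ X (v + u - t) * fcnt φ Y u +
        (-1) * fcnt φ W v * fsum φ Ψ X (v + u - t) * fcnt φ Y u + 1 * fcnt φ W v * fcnt φ X (v + u - t) * fsum φ Ψ Y u) := by
  rw [sum_filter_image₃_of_injOn φ Ψ hinj t]
  have e : ∀ p : A × A × A, Ψ (p.1 - p.2.1 + p.2.2) = 1 * Ψ p.1 + (-1) * Ψ p.2.1 + 1 * Ψ p.2.2 := fun p => by
    rw [map_add, map_sub]; ring
  simp_rw [e]
  exact sum_filter_triples_eq_sum φ Ψ W X Y (fun w x y => φ (w - x + y) = t) (fun v u => v + u - t)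
    (fun w x y => by
      rw [map_add, map_sub]
      constructor
      · intro h; rw [← h]; abel
      · intro h; rw [h]; abel) _ _ _

/-- `Ψ`-sums over the fibres of the direct signed sumset `W + X − Y`. [folklore] -/
theorem sum_fibre_box₃ (φ : A →+ B) (Ψ : A →+ R) {W X Y : Finset A}
    (hinj : Set.InjOn (fun p : A × A × A => p.1 + p.2.1 - p.2.2) ↑(W ×ˢ X ×ˢ Y)) (t : B) :
    ∑ a ∈ ((W ×ˢ X ×ˢ Y).image fun p : A × A × A => p.1 + p.2.1 - p.2.2).filter (fun a => φ a = t), Ψ a =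
      ∑ u : B, ∑ v : B, (1 * fsum φ Ψ W v * fcnt φ X (t + u - v) * fcnt φ Y u +
        1 * fcnt φ W v * fsum φ Ψ X (t + u - v) * fcnt φ Y u + (-1) * fcnt φ W v * fcnt φ X (t + u - v) * fsum φ Ψ Y u) := by
  rw [sum_filter_image₃_of_injOn φ Ψ hinj t]
  have e : ∀ p : A × A × A, Ψ (p.1 + p.2.1 - p.2.2) = 1 * Ψ p.1 + 1 * Ψ p.2.1 + (-1) * Ψ p.2.2 := fun p => by
    rw [map_sub, map_add]; ring
  simp_rw [e]
  exact sum_filter_triples_eq_sum φ Ψ W X Y (fun w x y => φ (w + x - y) = t) (fun v u => t + u - v)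
    (fun w x y => by
      rw [map_sub, map_add]
      constructor
      · intro h; rw [← h]; abel
      · intro h; rw [h]; abel) _ _ _

variable [Fintype A]

/-- **The fibre-moment identity of a three-set cube symmetric form** (weighted Radon identity): the three box contributions
(written with fibre counts `fcnt` and fibre sums `fsum` of `Ψ`) plus the hole term equal the full fibre sum of `Ψ`. [folklore] -/
theorem fibre_moment_identity (φ : A →+ B) (Ψ : A →+ R) {W X Y : Finset A} {x₀ : A}
    (h₁ : Set.InjOn (fun p : A × A × A => -p.1 + p.2.1 + p.2.2) ↑(W ×ˢ X ×ˢ Y))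
    (h₂ : Set.InjOn (fun p : A × A × A => p.1 - p.2.1 + p.2.2) ↑(W ×ˢ X ×ˢ Y))
    (h₃ : Set.InjOn (fun p : A × A × A => p.1 + p.2.1 - p.2.2) ↑(W ×ˢ X ×ˢ Y))
    (d₁₂ : Disjoint ((W ×ˢ X ×ˢ Y).image fun p : A × A × A => -p.1 + p.2.1 + p.2.2)
      ((W ×ˢ X ×ˢ Y).image fun p : A × A × A => p.1 - p.2.1 + p.2.2))
    (d₁₃ : Disjoint ((W ×ˢ X ×ˢ Y).image fun p : A × A × A => -p.1 + p.2.1 + p.2.2)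
      ((W ×ˢ X ×ˢ Y).image fun p : A × A × A => p.1 + p.2.1 - p.2.2))
    (d₂₃ : Disjoint ((W ×ˢ X ×ˢ Y).image fun p : A × A × A => p.1 - p.2.1 + p.2.2)
      ((W ×ˢ X ×ˢ Y).image fun p : A × A × A => p.1 + p.2.1 - p.2.2))
    (hcover : ((W ×ˢ X ×ˢ Y).image fun p : A × A × A => -p.1 + p.2.1 + p.2.2) ∪
      ((W ×ˢ X ×ˢ Y).image fun p : A × A × A => p.1 - p.2.1 + p.2.2) ∪
      ((W ×ˢ X ×ˢ Y).image fun p : A × A × A => p.1 + p.2.1 - p.2.2) = univ.erase x₀) (t : B) :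
    (∑ u : B, ∑ v : B,
      (fsum φ Ψ W v * (-fcnt φ X (t - u + v) + fcnt φ X (v + u - t) + fcnt φ X (t + u - v)) * fcnt φ Y u +
       fcnt φ W v * (fsum φ Ψ X (t - u + v) - fsum φ Ψ X (v + u - t) + fsum φ Ψ X (t + u - v)) * fcnt φ Y u +
       fcnt φ W v * (fcnt φ X (t - u + v) + fcnt φ X (v + u - t) - fcnt φ X (t + u - v)) * fsum φ Ψ Y u)) +
      (if φ x₀ = t then Ψ x₀ else 0) = ∑ a ∈ univ.filter (fun a : A => φ a = t), Ψ a := by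
  set P := (W ×ˢ X ×ˢ Y).image fun p : A × A × A => -p.1 + p.2.1 + p.2.2
  set Q := (W ×ˢ X ×ˢ Y).image fun p : A × A × A => p.1 - p.2.1 + p.2.2
  set S := (W ×ˢ X ×ˢ Y).image fun p : A × A × A => p.1 + p.2.1 - p.2.2
  have hsum : (∑ u : B, ∑ v : B,
      (fsum φ Ψ W v * (-fcnt φ X (t - u + v) + fcnt φ X (v + u - t) + fcnt φ X (t + u - v)) * fcnt φ Y u +
       fcnt φ W v * (fsum φ Ψ X (t - u + v) - fsum φ Ψ X (v + u - t) + fsum φ Ψ X (t + u - v)) * fcnt φ Y u +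
       fcnt φ W v * (fcnt φ X (t - u + v) + fcnt φ X (v + u - t) - fcnt φ X (t + u - v)) * fsum φ Ψ Y u)) =
      (∑ a ∈ P.filter (fun a => φ a = t), Ψ a) + (∑ a ∈ Q.filter (fun a => φ a = t), Ψ a) +
        ∑ a ∈ S.filter (fun a => φ a = t), Ψ a := by
    rw [sum_fibre_box₁ φ Ψ h₁, sum_fibre_box₂ φ Ψ h₂, sum_fibre_box₃ φ Ψ h₃, ← sum_add_distrib, ← sum_add_distrib]
    refine sum_congr rfl fun u _ => ?_
    rw [← sum_add_distrib, ← sum_add_distrib]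
    exact sum_congr rfl fun v _ => by ring
  rw [hsum]
  have hdPQ : Disjoint (P.filter fun a => φ a = t) (Q.filter fun a => φ a = t) := disjoint_filter_filter d₁₂
  have hdPS : Disjoint (P.filter fun a => φ a = t) (S.filter fun a => φ a = t) := disjoint_filter_filter d₁₃
  have hdQS : Disjoint (Q.filter fun a => φ a = t) (S.filter fun a => φ a = t) := disjoint_filter_filter d₂₃
  have hunion : (univ.filter fun a : A => φ a = t) =
      ((P ∪ Q ∪ S).filter fun a => φ a = t) ∪ (({x₀} : Finset A).filter fun a => φ a = t) := by
    rw [← filter_union, hcover]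
    congr 1
    ext a
    simp only [mem_union, mem_erase, mem_univ, mem_singleton, and_true]
    tauto
  have hdisj0 : Disjoint ((P ∪ Q ∪ S).filter fun a => φ a = t) (({x₀} : Finset A).filter fun a => φ a = t) := by
    apply disjoint_filter_filter
    rw [hcover, disjoint_singleton_right]
    exact fun h => (mem_erase.1 h).1 rfl
  rw [hunion, sum_union hdisj0, filter_union, filter_union, sum_union (disjoint_union_left.2 ⟨hdPS, hdQS⟩),
    sum_union hdPQ]
  congr 1
  rw [filter_singleton]
  split_ifs <;> simp

end Moment

/-! ## Collecting by the unknowns -/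

section Collect

variable {B R : Type*} [AddCommGroup B] [Fintype B] [DecidableEq B] [CommRing R]


/-- Coefficient of the fibre sum `Ws v` at fibre `t`: `α(t,v) = Σ_u (−Xc(t−u+v) + Xc(v+u−t) + Xc(t+u−v))·Yc(u)`. [folklore] -/
def momA (Xc Yc : B → R) (t v : B) : R := ∑ u : B, (-Xc (t - u + v) + Xc (v + u - t) + Xc (t + u - v)) * Yc u

/-- Coefficient of `Xs r` at fibre `t`: `β(t,r) = Σ_u Σ_v Wc(v)·Yc(u)·([t−u+v = r] − [v+u−t = r] + [t+u−v = r])`. [folklore] -/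
def momB (Wc Yc : B → R) (t r : B) : R :=
  ∑ u : B, ∑ v : B, Wc v * Yc u *
    ((if t - u + v = r then 1 else 0) - (if v + u - t = r then 1 else 0) + (if t + u - v = r then 1 else 0))

/-- Coefficient of `Ys u` at fibre `t`: `γ(t,u) = Σ_v Wc(v)·(Xc(t−u+v) + Xc(v+u−t) − Xc(t+u−v))`. [folklore] -/
def momC (Wc Xc : B → R) (t u : B) : R := ∑ v : B, Wc v * (Xc (t - u + v) + Xc (v + u - t) - Xc (t + u - v))

omit [AddCommGroup B] in
/-- A sum `Σ_r Xs r · [e = r]` picks `Xs e`. [folklore] -/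
theorem sum_mul_ite_eq' (Xs : B → R) (e : B) : ∑ r : B, Xs r * (if e = r then (1 : R) else 0) = Xs e := by
  rw [Finset.sum_eq_single e]
  · simp
  · intro r _ hr; rw [if_neg (Ne.symm hr), mul_zero]
  · intro h; exact absurd (mem_univ e) h

/-- **Collected form**: the raw double sum of `fibre_moment_identity` equals
`Σ_v Ws v·α(t,v) + Σ_r Xs r·β(t,r) + Σ_u Ys u·γ(t,u)` (pure algebra, any functions). [folklore] -/
theorem fibre_moment_collected (Wc Xc Yc Ws Xs Ys : B → R) (t : B) :
    (∑ u : B, ∑ v : B,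
      (Ws v * (-Xc (t - u + v) + Xc (v + u - t) + Xc (t + u - v)) * Yc u +
       Wc v * (Xs (t - u + v) - Xs (v + u - t) + Xs (t + u - v)) * Yc u +
       Wc v * (Xc (t - u + v) + Xc (v + u - t) - Xc (t + u - v)) * Ys u)) =
      (∑ v : B, Ws v * momA Xc Yc t v) + (∑ r : B, Xs r * momB Wc Yc t r) + ∑ u : B, Ys u * momC Wc Xc t u := by
  classical
  have hA : (∑ v : B, Ws v * momA Xc Yc t v) =
      ∑ u : B, ∑ v : B, Ws v * (-Xc (t - u + v) + Xc (v + u - t) + Xc (t + u - v)) * Yc u := by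
    unfold momA
    rw [sum_comm]
    refine sum_congr rfl fun v _ => ?_
    rw [mul_sum]
    exact sum_congr rfl fun u _ => by ring
  have hC : (∑ u : B, Ys u * momC Wc Xc t u) =
      ∑ u : B, ∑ v : B, Wc v * (Xc (t - u + v) + Xc (v + u - t) - Xc (t + u - v)) * Ys u := by
    unfold momC
    refine sum_congr rfl fun u _ => ?_
    rw [mul_sum]
    exact sum_congr rfl fun v _ => by ring
  have hB : (∑ r : B, Xs r * momB Wc Yc t r) =
      ∑ u : B, ∑ v : B, Wc v * (Xs (t - u + v) - Xs (v + u - t) + Xs (t + u - v)) * Yc u := by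
    unfold momB
    have e1 : (∑ r : B, Xs r * ∑ u : B, ∑ v : B, Wc v * Yc u *
        ((if t - u + v = r then 1 else 0) - (if v + u - t = r then 1 else 0) + (if t + u - v = r then 1 else 0))) =
        ∑ u : B, ∑ v : B, ∑ r : B, Xs r * (Wc v * Yc u *
          ((if t - u + v = r then 1 else 0) - (if v + u - t = r then 1 else 0) + (if t + u - v = r then 1 else 0))) := by
      simp_rw [mul_sum]
      rw [sum_comm]
      exact sum_congr rfl fun u _ => sum_comm
    rw [e1]
    refine sum_congr rfl fun u _ => sum_congr rfl fun v _ => ?_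
    have e2 : ∀ r : B, Xs r * (Wc v * Yc u *
        ((if t - u + v = r then 1 else 0) - (if v + u - t = r then 1 else 0) + (if t + u - v = r then 1 else 0))) =
        Wc v * Yc u * (Xs r * (if t - u + v = r then 1 else 0)) - Wc v * Yc u * (Xs r * (if v + u - t = r then 1 else 0)) +
          Wc v * Yc u * (Xs r * (if t + u - v = r then 1 else 0)) := fun r => by ring
    rw [Fintype.sum_congr _ _ e2, sum_add_distrib, sum_sub_distrib, ← mul_sum, ← mul_sum, ← mul_sum,
      sum_mul_ite_eq', sum_mul_ite_eq', sum_mul_ite_eq']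
    ring
  rw [hA, hB, hC, ← sum_add_distrib, ← sum_add_distrib]
  refine sum_congr rfl fun u _ => ?_
  rw [← sum_add_distrib, ← sum_add_distrib]

omit [AddCommGroup B] in
/-- **Pairing with a test vector.**  From the collected identities `Σ_v Ws v α(t,v) + Σ_r Xs r β(t,r) + Σ_u Ys u γ(t,u) +
[s = t]·s₀ = ρ t` for all `t` and any `λ : B → R`:
`Σ_v Ws v·(Σ_t λ t α(t,v)) + Σ_r Xs r·(Σ_t λ t β(t,r)) + Σ_u Ys u·(Σ_t λ t γ(t,u)) + λ s · s₀ = Σ_t λ t ρ t`. [folklore] -/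
theorem moment_pairing (α β γ : B → B → R) (Ws Xs Ys ρ : B → R) (s : B) (s₀ : R)
    (hid : ∀ t : B, (∑ v : B, Ws v * α t v) + (∑ r : B, Xs r * β t r) + (∑ u : B, Ys u * γ t u) +
      (if s = t then s₀ else 0) = ρ t) (lam : B → R) :
    (∑ v : B, Ws v * ∑ t : B, lam t * α t v) + (∑ r : B, Xs r * ∑ t : B, lam t * β t r) +
      (∑ u : B, Ys u * ∑ t : B, lam t * γ t u) + lam s * s₀ = ∑ t : B, lam t * ρ t := by
  have h : ∑ t : B, lam t * ρ t = ∑ t : B, lam t * ((∑ v : B, Ws v * α t v) + (∑ r : B, Xs r * β t r) +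
      (∑ u : B, Ys u * γ t u) + (if s = t then s₀ else 0)) := sum_congr rfl fun t _ => by rw [hid t]
  rw [h]
  simp only [mul_add, sum_add_distrib, mul_ite, mul_zero, sum_ite_eq, mem_univ, if_true]
  congr 1; congr 1
  · congr 1
    · simp_rw [mul_sum]; rw [sum_comm]; exact sum_congr rfl fun v _ => sum_congr rfl fun t _ => by ring
    · simp_rw [mul_sum]; rw [sum_comm]; exact sum_congr rfl fun v _ => sum_congr rfl fun t _ => by ring
  · simp_rw [mul_sum]; rw [sum_comm]; exact sum_congr rfl fun v _ => sum_congr rfl fun t _ => by ring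

end Collect

end FibreMoment

end Summit.MatrixMultiplication.OmegaCensus
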